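import Mathlib.NumberTheory.ArithmeticFunction.Liouville
import Mathlib.NumberTheory.ArithmeticFunction.Moebius
import Mathlib.Data.Set.Finite.Basic
import HarnessLib

/-!
# Liouville's and Möbius' functions are not automatic sequences (Coons 2010; named facts)

Published, unformalised results of M. Coons, *(Non)Automaticity of number theoretic functions*,
J. Théor. Nombres Bordeaux 22 (2010) 339–352 (= arXiv:0810.3709), vendored AS PRINTED as
`def … : Prop` named facts (CONVENTIONS §4), together with the (real) definitions they need:

* `kKernel k t` — the `k`-kernel of a sequence `t : ℕ → α`: the set of subsequences
  `n ↦ t (k^l n + r)`, `l ≥ 0`, `0 ≤ r < k^l` (Coons 2010, §1, display before Thm 1.1;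
  Allouche–Shallit 2003, §6.6).
* `IsKAutomatic k t` — "`t` is `k`-automatic" in COONS'S OWN DEFINITION (§1: "Given `k ≥ 2`, we
  say a sequence **T** is `k`-automatic if and only if the `k`-kernel of **T** is finite"). For
  sequences over a finite alphabet this is equivalent to generation by a deterministic finite
  automaton with output reading the base-`k` digits (in either digit order) — Eilenberg's theorem,
  Allouche–Shallit 2003, Thm 6.6.2 with Thm 5.2.3 —, and to regularity of every fibre
  `{(n)_k : t n = d}` (Allouche–Shallit 2003, Lemma 5.2.6). Those equivalences are NOT vendored
  here; a consumer wanting `¬ Language.IsRegular …` for a fibre language must supply the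
  (routine, Myhill–Nerode) direction "regular fibres ⇒ finite kernel".
* `coons_liouville_not_automatic` — Thm 1.5: `λ` is not `k`-automatic for any `k ≥ 2`.
* `coons_Omega_mod_two_not_automatic` — Cor 1.7: `(Ω(n) mod 2)` is not `2`-automatic.
* `coons_moebius_not_automatic` — Thm 2.8: `μ` is not `k`-automatic for any `k ≥ 2`.
* `IsKAutomatic.comp` — Lemma 1.6 (the image of a `k`-automatic sequence under any map is
  `k`-automatic), PROVED (it is immediate from the kernel definition).
* `IsKAutomatic.update_zero` — kernel finiteness does not see the value at the index `0`, PROVED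
  (the formal content of the indexing remark below; Allouche–Shallit 2003, Thm 5.4.1 in general).
* `coons_Omega_mod_two_not_automatic_of_liouville` — PROVED: Cor 1.7 follows from Thm 1.5 exactly
  as in the paper (`Ω mod 2 = (1 - λ)/2`, Lemma 1.6), so the trust base of a consumer of the
  `Ω mod 2` form is the single fact `coons_liouville_not_automatic`.

Duplicate notice (librarian): the same two definitions and Thm 1.5 / Cor 1.7 were vendored
concurrently as `Literature.Computability.Complexity.kKernel / IsKAutomatic /
coons_liouville_not_automatic / coons_cardFactors_mod_two_not_automatic`
(`Literature/Computability/Complexity/AutomaticSequences.lean`, p39747, accepted 90 s before this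
file's p39824); the statements agree symbol for symbol up to namespace, so one of the two files
should be retired or turned into re-exports — recorded on item stmt-QuantumAdvantage-1399.

Indexing convention. Coons indexes his sequences by `n ≥ 1` while the kernel subsequences run over
`n ≥ 0` (so the value at `0` is implicitly some fixed symbol); Allouche–Shallit index from `0`.
Here sequences are `ℕ → α` with Mathlib's values at `0` (`λ 0 = 0`, `μ 0 = 0`, `Ω 0 = 0`, an extra
symbol). This is immaterial: changing a sequence at the single index `0` changes each kernel
element at most at the index `0` and to a fixed value, so finiteness of the kernel is unaffected
(cf. Allouche–Shallit 2003, Thm 5.4.1: finite modifications preserve automaticity).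

These facts ground the "automatic rung" `Summit.QuantumAdvantage.QuantumAdvantage.Theses.MobiusLadder.LiouvilleLangNotRegular`
(item stmt-QuantumAdvantage-1399: the LSB-first binary codes of `{N : λ N = -1}` do not form a regular
language) = `coons_Omega_mod_two_not_automatic` (or `coons_liouville_not_automatic` at `k = 2`)
∘ [regular fibre ⇒ finite `2`-kernel], and the automatic side rung of route `PneNP/Mobius`.
What is NOT here: Müllner 2017 (automatic sequences are orthogonal to `μ`), the
Allouche–Mendès France–Peyrière meromorphy theorem used in Coons's proof, `k`-regular sequences (§3).
-/

namespace Literature.NumberTheory.LFunctions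

/-- The **`k`-kernel** of a sequence `t : ℕ → α`: the set of subsequences
`(t(k^l n + r))_{n ≥ 0}` with `l ≥ 0` and `0 ≤ r < k^l` (Coons 2010, §1; Allouche–Shallit 2003,
§6.6, `K_k(u)`). [cite: Coons2011, §1 (definition of the k-kernel)] -/
def kKernel {α : Type*} (k : ℕ) (t : ℕ → α) : Set (ℕ → α) :=
  {u | ∃ l r : ℕ, r < k ^ l ∧ u = fun n => t (k ^ l * n + r)}

/-- **`k`-automatic sequence**, in Coons's definition: "Given `k ≥ 2`, we say a sequence **T** is
`k`-automatic if and only if the `k`-kernel of **T** is finite" (Coons 2010, §1; this is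
Eilenberg's characterisation, Allouche–Shallit 2003, Thm 6.6.2, of sequences generated by finite
automata with output). A sequence with finite `k`-kernel (`k ≥ 2`) automatically takes only
finitely many values. [cite: Coons2011, §1 (definition of k-automatic)] -/
def IsKAutomatic {α : Type*} (k : ℕ) (t : ℕ → α) : Prop :=
  (kKernel k t).Finite

/-- **Coons 2010, Lemma 1.6** (proved): "Let `t : ℕ → Y` and `Φ : Y → Z` be mappings. If
`(t(n))_{n≥1}` is `k`-automatic for some `k ≥ 2`, then `(Φ(t(n)))_{n≥1}` is also `k`-automatic" —
the kernel of `Φ ∘ t` is the image of the kernel of `t` under `(Φ ∘ ·)`. [cite: Coons2011, Lemma 1.6] -/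
theorem IsKAutomatic.comp {α β : Type*} {k : ℕ} {t : ℕ → α} (h : IsKAutomatic k t) (Φ : α → β) :
    IsKAutomatic k (Φ ∘ t) := by
  refine (h.image fun u => Φ ∘ u).subset ?_
  rintro u ⟨l, r, hr, rfl⟩
  exact ⟨fun n => t (k ^ l * n + r), ⟨l, r, hr, rfl⟩, rfl⟩

/-- **Coons 2010, Theorem 1.5.** Printed statement: "Liouville's function, `λ`, is not
`k`-automatic for any `k ≥ 2`, and hence `Σ_{n≥1} λ(n)Xⁿ ∈ 𝔽_p[[X]]` is transcendental over
`𝔽_p(X)` for all `p > 2`." Only the first clause is vendored. `λ = ArithmeticFunction.liouville`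
(`λ 0 = 0`, immaterial for kernel finiteness — see the module docstring); `k`-automatic =
finite `k`-kernel (`IsKAutomatic`, Coons's definition). Proof in print: Allouche–Mendès France–Peyrière
(automatic Dirichlet series continue meromorphically with poles on finitely many left half-lattices)
against the `≫ T log T` poles of `ζ(2s)/ζ(s)` on `Re s = 1/4` from zeros of `ζ` on the critical line.
Grounds `Summit.QuantumAdvantage.QuantumAdvantage.Theses.MobiusLadder.LiouvilleLangNotRegular` (with the
regular-fibre ⇒ finite-kernel direction of Allouche–Shallit Lemma 5.2.6/Thm 6.6.2, not vendored).
[cite: Coons2011, Theorem 1.5] -/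
def coons_liouville_not_automatic : Prop :=
  ∀ k : ℕ, 2 ≤ k → ¬ IsKAutomatic k (fun n => ArithmeticFunction.liouville n)

/-- **Coons 2010, Corollary 1.7.** Printed statement: "The function `(Ω(n) mod 2)` is not
`2`-automatic; furthermore, the series `Σ_{n≥1} Ω(n)Xⁿ` is transcendental over both `𝔽₂(X)` and
`ℤ(X)`." Only the first clause is vendored; `Ω = ArithmeticFunction.cardFactors` (number of prime
factors with multiplicity, `Ω 0 = Ω 1 = 0`). Note `{n : Ω n % 2 = 1} = {n : λ n = -1}` exactly
(`λ n = (-1)^{Ω n}` for `n ≠ 0`, and `0` lies in neither set).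
[cite: Coons2011, Corollary 1.7] -/
def coons_Omega_mod_two_not_automatic : Prop :=
  ¬ IsKAutomatic 2 (fun n => ArithmeticFunction.cardFactors n % 2)

/-- **Coons 2010, Theorem 2.8.** Printed statement: "The sequence `(μ(n))_{n≥1}` is not
`k`-automatic for any `k ≥ 2`; and hence the series `Σ_{n≥1} μ(n)Xⁿ` is transcendental over both
`𝔽_p(X)`, for all primes `p`, and `ℤ(X)`." Only the first clause is vendored;
`μ = ArithmeticFunction.moebius` (`μ 0 = 0`). [cite: Coons2011, Theorem 2.8] -/
def coons_moebius_not_automatic : Prop :=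
  ∀ k : ℕ, 2 ≤ k → ¬ IsKAutomatic k (fun n => ArithmeticFunction.moebius n)

/-- Kernel finiteness is insensitive to the value at the index `0` (each kernel element with
`r ≠ 0` never reads the index `0`; those with `r = 0` read it only at `n = 0`), cf.
Allouche–Shallit 2003, Thm 5.4.1. [cite: AlloucheShallit2003, Theorem 5.4.1] -/
theorem IsKAutomatic.update_zero {α : Type*} {k : ℕ} {t : ℕ → α} (h : IsKAutomatic k t) (a : α) :
    IsKAutomatic k (Function.update t 0 a) := by
  refine (h.union (h.image fun u => Function.update u 0 a)).subset ?_
  rintro u ⟨l, r, hr, rfl⟩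
  have hkl : 0 < k ^ l := lt_of_le_of_lt (Nat.zero_le r) hr
  rcases eq_or_ne r 0 with rfl | hr0
  · right
    refine ⟨fun n => t (k ^ l * n + 0), ⟨l, 0, hr, rfl⟩, ?_⟩
    funext n
    show Function.update (fun n => t (k ^ l * n + 0)) 0 a n = Function.update t 0 a (k ^ l * n + 0)
    rcases eq_or_ne n 0 with rfl | hn
    · simp
    · have hne : k ^ l * n + 0 ≠ 0 := by
        rw [add_zero]; exact Nat.mul_ne_zero (Nat.pos_iff_ne_zero.mp hkl) hn
      rw [Function.update_of_ne hn, Function.update_of_ne hne]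
  · left
    refine ⟨l, r, hr, ?_⟩
    funext n
    have hne : k ^ l * n + r ≠ 0 := by omega
    rw [Function.update_of_ne hne]

/-- **Coons 2010, Corollary 1.7 from Theorem 1.5** (as in the paper: `(Ω(n) mod 2) = (1 - λ(n))/2`
and Lemma 1.6): the named fact `coons_Omega_mod_two_not_automatic` follows from
`coons_liouville_not_automatic`, so consumers may take the latter only.
[cite: Coons2011, Corollary 1.7] -/
theorem coons_Omega_mod_two_not_automatic_of_liouville (h : coons_liouville_not_automatic) :
    coons_Omega_mod_two_not_automatic := by
  intro hΩ
  apply h 2 le_rfl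
  have h1 : IsKAutomatic 2 ((fun v : ℕ => (1 : ℤ) - 2 * (v : ℤ)) ∘
      fun n => ArithmeticFunction.cardFactors n % 2) := hΩ.comp _
  have h2 := h1.update_zero 0
  convert h2 using 1
  funext n
  rcases eq_or_ne n 0 with rfl | hn
  · simp
  · rw [Function.update_of_ne hn, Function.comp_apply, ArithmeticFunction.liouville_apply hn]
    rcases Nat.even_or_odd (ArithmeticFunction.cardFactors n) with he | ho
    · rw [he.neg_one_pow, Nat.even_iff.mp he]; simp
    · rw [ho.neg_one_pow, Nat.odd_iff.mp ho]; simp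

end Literature.NumberTheory.LFunctions
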